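import Literature.Probability.Percolation.CLE6
import Literature.Probability.LatticeModels.TriangularLatticeProofs
import Mathlib.Topology.MetricSpace.Thickening
import Mathlib.Analysis.Normed.Module.Convex
import HarnessLib

/-!
# Critical percolation loop collections: the interface loops stay within `δ` of the domain

Topic `Literature/Probability/Percolation`, companion to `CLE6.lean`. This file PROVES the named
fact `Literature.Probability.Percolation.range_subset_cthickening_of_mem_triLoopCollection` of `CLE6.lean`
(`range_subset_cthickening_of_mem_triLoopCollection_holds`): every member of the percolation
loop collection `triLoopCollection D δ ω` at mesh `δ > 0` has trace in the closed `δ`-thickening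
`Metric.cthickening δ D.carrier` of the Jordan domain `D`.

The fact is a property of the tree's own construction of the loop collection (closed boundary
condition realised by closing every site whose rescaled position lies outside `D`), following
F. Camia, C. M. Newman, *Two-dimensional critical percolation: the full scaling limit*, Comm.
Math. Phys. 268 (2006), §4 (p. 10: the boundary of a cluster is its Peierls contour, the set of
edges of the hexagonal lattice surrounding the hexagons of the cluster; p. 11: the lattice
approximation `D^δ` of `D` is made of hexagons of `δ𝓗` contained in `D`). The printed source
contains no separate statement of it; the proof below is elementary lattice geometry:

* `SimpleGraph.Walk.range_toCurve_subset` — the trace of the polyline of a walk lies in any set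
  containing the segments of all its darts (`Path.trans_range`, `Path.range_segment`);
* `Literature.Probability.Percolation.norm_hexCenter_triEdgeFaces_sub_le_one` — the centres of the two faces of `𝕋`
  bordering a dart `x → y` are within distance `1` (in fact `1/√3`) of `triEmbed x`: reduction to
  `x = 0` by translation covariance of `triFace` (`triFace_add`), the faces of the six darts
  `0 → v` (`neighborFinset_triGraph_eq`) identified by `decide` (`triFace_dir_mem`), and their
  centres computed explicitly with `ζ = 1/2 + i√3/2` (`norm_hexCenter_triFace_le_one`);
* assembly: each dart of an interface loop of `ω ∩ triMeshVertices D δ` has an open site `x` on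
  its left with `δ · triEmbed x ∈ D`, so its (rescaled) segment lies in the convex ball
  `closedBall (δ · triEmbed x) δ ⊆ cthickening δ D`; the set of curve classes with trace in the
  closed set `cthickening δ D` is closed (`CurveClass.isClosed_rangeSubset`), so the property
  passes to the closure `triLoopCollection`.

## References

* F. Camia, C. M. Newman, *Two-dimensional critical percolation: the full scaling limit*,
  Comm. Math. Phys. 268 (2006), 1–38, §4 [CamiaNewman2006].
* G. Grimmett, *Percolation*, 2nd ed. (1999), §1.6, Fig. 1.7 (the hexagonal dual of `𝕋`).
-/

noncomputable section

open Set Metric Complex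

/-! ### Traces of polylines of walks -/

namespace SimpleGraph.Walk

variable {V E : Type*} [AddCommGroup E] [Module ℝ E] [TopologicalSpace E] [ContinuousAdd E]
  [ContinuousSMul ℝ E] {G : SimpleGraph V}

/-- The trace of the curve of a trivial walk is the (embedded) base vertex
(Camia–Newman 2007, §2: lattice paths as polygonal curves). A deliberate dot-notation extension
of Mathlib's `SimpleGraph.Walk`, like `SimpleGraph.Walk.toCurve`. [folklore] -/
theorem range_toCurve_nil (emb : V → E) (u : V) :
    Set.range ((nil : G.Walk u u).toCurve emb) = {emb u} := by
  simp [toCurve, Literature.Probability.LatticeModels.polyline]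

/-- The trace of the curve of `cons h p` is the first segment followed by the trace of the curve
of `p` (Camia–Newman 2007, §2). [folklore] -/
theorem range_toCurve_cons (emb : V → E) {u v w : V} (h : G.Adj u v) (p : G.Walk v w) :
    Set.range ((cons h p).toCurve emb) =
      segment ℝ (emb u) (emb v) ∪ Set.range (p.toCurve emb) := by
  cases p <;> simp [toCurve, Literature.Probability.LatticeModels.polyline, Path.trans_range, Path.range_segment]

/-- **The trace of the polyline of a walk is controlled by its darts**: if `S` contains the
embedded base vertex and the segment `[emb x, emb y]` of every dart `x → y` of the walk, then
the trace of `p.toCurve emb` lies in `S` (Camia–Newman 2007, §2). [folklore] -/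
theorem range_toCurve_subset {S : Set E} {emb : V → E} :
    ∀ {u v : V} (p : G.Walk u v), emb u ∈ S →
      (∀ d ∈ p.darts, segment ℝ (emb d.fst) (emb d.snd) ⊆ S) → Set.range (p.toCurve emb) ⊆ S
  | _, _, nil, hu, _ => by
    rw [range_toCurve_nil]
    exact singleton_subset_iff.2 hu
  | _, _, cons h p, _, hd => by
    rw [range_toCurve_cons]
    rw [darts_cons] at hd
    have h1 := hd _ List.mem_cons_self
    exact union_subset h1 (range_toCurve_subset p (h1 (right_mem_segment ℝ _ _))
      fun d hd' ↦ hd d (List.mem_cons_of_mem _ hd'))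

/-- Variant of `range_toCurve_subset` for non-trivial walks: the base vertex is an endpoint of
the first dart, so only the dart condition is needed (Camia–Newman 2007, §2). [folklore] -/
theorem range_toCurve_subset_of_not_nil {S : Set E} {emb : V → E} {u v : V} {p : G.Walk u v}
    (hp : ¬ p.Nil) (hd : ∀ d ∈ p.darts, segment ℝ (emb d.fst) (emb d.snd) ⊆ S) :
    Set.range (p.toCurve emb) ⊆ S := by
  cases p with
  | nil => exact absurd nil_nil hp
  | cons h q =>
    exact range_toCurve_subset _ (hd ⟨(u, _), h⟩ List.mem_cons_self (left_mem_segment ℝ _ _)) hd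

end SimpleGraph.Walk

/-! ### Face centres are close to the sites of the face -/

namespace Literature.Probability.Percolation

open Finset

/-- A complex number of squared norm at most `1` has norm at most `1`. [folklore] -/
theorem norm_le_one_of_normSq_le_one {z : ℂ} (h : Complex.normSq z ≤ 1) : ‖z‖ ≤ 1 := by
  rw [Complex.normSq_eq_norm_sq] at h
  nlinarith [norm_nonneg z]

/-- **The faces around the origin.** For each of the six directions `v` of `𝕋`, the faces to the
left and to the right of the dart `0 → v` (as computed by `triFace`, cf. `triEdgeFaces`) are,
respectively: `e₀ ↦` (up `0`, down `-e₁`); `-e₀ ↦` (down `-e₀-e₁`, up `-e₀`); `e₁ ↦` (down `-e₀`,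
up `0`); `-e₁ ↦` (up `-e₁`, down `-e₀-e₁`); `e₀-e₁ ↦` (down `-e₁`, up `-e₁`); `e₁-e₀ ↦` (up `-e₀`,
down `-e₀`) — six of the twelve (face, face) pairs built from the six faces around the origin
(Grimmett 1999, §1.6, Fig. 1.7). Verified by `decide`. [folklore] -/
theorem triFace_dir_mem :
    ∀ v ∈ ({Pi.single 0 1, -Pi.single 0 1, Pi.single 1 1, -Pi.single 1 1, LatticeModels.triDiag, -LatticeModels.triDiag} :
        Finset (LatticeModels.Site 2)),
      (LatticeModels.triFace 0 v (LatticeModels.triRot60 v), LatticeModels.triFace 0 v (LatticeModels.triRotNeg60 v)) ∈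
        ({((0, 0), (-Pi.single 1 1, 1)),
          ((-(Pi.single 0 1 + Pi.single 1 1), 1), (-Pi.single 0 1, 0)),
          ((-Pi.single 0 1, 1), (0, 0)),
          ((-Pi.single 1 1, 0), (-(Pi.single 0 1 + Pi.single 1 1), 1)),
          ((-Pi.single 1 1, 1), (-Pi.single 1 1, 0)),
          ((-Pi.single 0 1, 0), (-Pi.single 0 1, 1))} : Finset (LatticeModels.HexVertex × LatticeModels.HexVertex)) := by
  decide

/-- The centres of the faces to the left and to the right of the dart `0 → v`, for each of the
six directions `v` of `𝕋`, are within distance `1` of the origin (their distance is the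
circumradius `1/√3` of a unit equilateral triangle; computed with `ζ = 1/2 + i√3/2`)
(Werner 2009, §1; Grimmett 1999, §1.6). [folklore] -/
theorem norm_hexCenter_triFace_le_one {v : LatticeModels.Site 2}
    (hv : v ∈ ({Pi.single 0 1, -Pi.single 0 1, Pi.single 1 1, -Pi.single 1 1, LatticeModels.triDiag, -LatticeModels.triDiag} :
        Finset (LatticeModels.Site 2))) :
    ‖LatticeModels.hexCenter (LatticeModels.triFace 0 v (LatticeModels.triRot60 v))‖ ≤ 1 ∧ ‖LatticeModels.hexCenter (LatticeModels.triFace 0 v (LatticeModels.triRotNeg60 v))‖ ≤ 1 := by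
  have h3 : Real.sqrt 3 * Real.sqrt 3 = 3 := Real.mul_self_sqrt (by norm_num)
  have hk := triFace_dir_mem v hv
  simp only [Finset.mem_insert, Finset.mem_singleton, Prod.mk.injEq] at hk
  rcases hk with ⟨h1, h2⟩ | ⟨h1, h2⟩ | ⟨h1, h2⟩ | ⟨h1, h2⟩ | ⟨h1, h2⟩ | ⟨h1, h2⟩ <;>
    rw [h1, h2] <;> constructor <;> apply norm_le_one_of_normSq_le_one <;>
    simp [LatticeModels.hexCenter, LatticeModels.triEmbed_neg, LatticeModels.triEmbed_add, Complex.normSq_apply] <;>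
    nlinarith [h3]

/-- Translation covariance of face centres: the centre of the face `triFace x (x + v) (x + w)`,
seen from `triEmbed x`, is the centre of `triFace 0 v w` (`triFace_add`, `triEmbed_add`).
[folklore] -/
theorem hexCenter_triFace_sub (x v w : LatticeModels.Site 2) :
    LatticeModels.hexCenter (LatticeModels.triFace x (x + v) (x + w)) - LatticeModels.triEmbed x = LatticeModels.hexCenter (LatticeModels.triFace 0 v w) := by
  have h := LatticeModels.triFace_add x 0 v w
  rw [add_zero] at h
  rw [h]
  simp only [LatticeModels.hexCenter, LatticeModels.triEmbed_add]
  ring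

/-- **The two faces bordering a dart are close to its tail**: for a dart `x → y` of `𝕋`, the
centres of its left and right faces `triEdgeFaces` are within distance `1` of `triEmbed x`
(in fact at distance `1/√3`: `x` is a vertex of both unit equilateral triangles)
(Grimmett 1999, §1.6, Fig. 1.7; Werner 2009, §1). [folklore] -/
theorem norm_hexCenter_triEdgeFaces_sub_le_one (e : LatticeModels.triGraph.Dart) :
    ‖LatticeModels.hexCenter (LatticeModels.triEdgeFaces e).1 - LatticeModels.triEmbed e.fst‖ ≤ 1 ∧
      ‖LatticeModels.hexCenter (LatticeModels.triEdgeFaces e).2 - LatticeModels.triEmbed e.fst‖ ≤ 1 := by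
  obtain ⟨⟨x, y⟩, hxy⟩ := e
  change ‖LatticeModels.hexCenter (LatticeModels.triFace x y (x + LatticeModels.triRot60 (y - x))) - LatticeModels.triEmbed x‖ ≤ 1 ∧
    ‖LatticeModels.hexCenter (LatticeModels.triFace x y (x + LatticeModels.triRotNeg60 (y - x))) - LatticeModels.triEmbed x‖ ≤ 1
  have hy : y ∈ LatticeModels.triGraph.neighborFinset x := (SimpleGraph.mem_neighborFinset _ _ _).2 hxy
  rw [LatticeModels.neighborFinset_triGraph_eq, Finset.mem_image] at hy
  obtain ⟨v, hv, rfl⟩ := hy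
  rw [add_sub_cancel_left, hexCenter_triFace_sub, hexCenter_triFace_sub]
  exact norm_hexCenter_triFace_le_one hv

/-- Rescaled version: at mesh `δ ≥ 0` the centres of the two faces of a dart `x → y` lie in the
closed ball of radius `δ` about the mesh point `δ · triEmbed x` (Camia–Newman 2006, §4).
[folklore] -/
theorem hexCenter_triEdgeFaces_mem_closedBall {δ : ℝ} (hδ : 0 ≤ δ) (e : LatticeModels.triGraph.Dart) :
    (δ : ℂ) * LatticeModels.hexCenter (LatticeModels.triEdgeFaces e).1 ∈ closedBall (LatticeModels.triMeshPoint δ e.fst) δ ∧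
      (δ : ℂ) * LatticeModels.hexCenter (LatticeModels.triEdgeFaces e).2 ∈ closedBall (LatticeModels.triMeshPoint δ e.fst) δ := by
  obtain ⟨h1, h2⟩ := norm_hexCenter_triEdgeFaces_sub_le_one e
  simp only [mem_closedBall, LatticeModels.triMeshPoint, dist_eq_norm, ← mul_sub, norm_mul,
    Complex.norm_real, Real.norm_eq_abs, abs_of_nonneg hδ]
  exact ⟨mul_le_of_le_one_right hδ h1, mul_le_of_le_one_right hδ h2⟩

end Literature.Probability.Percolation

/-! ### The fact -/

namespace Literature.Probability.Percolation

open LatticeModels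

/-- Every dart of a site interface loop of the restricted configuration
`ω ∩ triMeshVertices Ω δ` (`δ ≥ 0`) has its rescaled dual segment inside the closed
`δ`-thickening of `Ω`: the open site on its left is a mesh vertex `x` with `δ · triEmbed x ∈ Ω`,
and both ends of the segment are within `δ` of it (Camia–Newman 2006, §4, p. 10: cluster
boundaries run along the edges of the hexagons of the cluster). [cite: CamiaNewman2006, §4] -/
theorem segment_subset_cthickening_of_isSiteInterfaceLoop {Ω : Set ℂ} {δ : ℝ} (hδ : 0 ≤ δ)
    {ω : SiteConfig (Site 2)} {f : HexVertex} {γ : hexGraph.Walk f f}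
    (hγ : IsSiteInterfaceLoop (ω ∩ triMeshVertices Ω δ) γ) {d : hexGraph.Dart} (hd : d ∈ γ.darts) :
    segment ℝ ((δ : ℂ) * hexCenter d.fst) ((δ : ℂ) * hexCenter d.snd) ⊆ cthickening δ Ω := by
  obtain ⟨e, he, hx, -⟩ := hγ.2 d hd
  have hfst : d.fst = (triEdgeFaces e).2 := by rw [he]
  have hsnd : d.snd = (triEdgeFaces e).1 := by rw [he]
  obtain ⟨h1, h2⟩ := hexCenter_triEdgeFaces_mem_closedBall hδ e
  rw [hfst, hsnd]
  exact ((convex_closedBall _ _).segment_subset h2 h1).trans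
    (closedBall_subset_cthickening (mem_triMeshVertices_iff.1 hx.2) δ)

/-- **`range_subset_cthickening_of_mem_triLoopCollection` holds**: every member of the
percolation loop collection `triLoopCollection D δ ω` at mesh `δ > 0` has trace in
`Metric.cthickening δ D.carrier`. The generating classes are polylines whose dart segments lie in
the thickening (`segment_subset_cthickening_of_isSiteInterfaceLoop`,
`SimpleGraph.Walk.range_toCurve_subset_of_not_nil`; interface loops are cycles, hence
non-trivial walks), and having trace in a closed set is a closed condition in curve space
(`CurveClass.isClosed_rangeSubset`, `Metric.isClosed_cthickening`), so it passes to the closure.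
Camia–Newman 2006, §4 (pp. 10–11: cluster boundaries are Peierls contours along the edges of
the hexagons of `δ𝓗` in `D`). [cite: CamiaNewman2006, §4] -/
theorem range_subset_cthickening_of_mem_triLoopCollection_holds :
    range_subset_cthickening_of_mem_triLoopCollection := by
  intro D δ hδ ω c hc
  rw [← RandomPlanarGeometry.CurveClass.mem_rangeSubset]
  refine closure_minimal ?_ (RandomPlanarGeometry.CurveClass.isClosed_rangeSubset isClosed_cthickening) hc
  rintro _ ⟨f, γ, hγ, rfl⟩
  change Set.range (γ.toCurve fun v ↦ (δ : ℂ) * hexCenter v) ⊆ cthickening δ D.carrier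
  exact SimpleGraph.Walk.range_toCurve_subset_of_not_nil hγ.isCycle.not_nil
    fun d hd ↦ segment_subset_cthickening_of_isSiteInterfaceLoop hδ.le hγ hd

end Literature.Probability.Percolation

/-! ### Measurability of the loop collection at fixed mesh -/

namespace Literature.Probability.Percolation

open LatticeModels MeasureTheory

/-- The loop collection only depends on the configuration through the sites of the mesh
restriction `triMeshVertices D.carrier δ`: configurations with the same trace on it have the same
interface loops (Camia–Newman 2006, §2.2 and §4: the curves at mesh `δ` are the polygonal cluster
boundaries of the configuration in `D`). [cite: CamiaNewman2006, §2.2 and §4] -/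
theorem triLoopCollection_eq_of_inter_eq {D : RandomPlanarGeometry.JordanDomain} {δ : ℝ}
    {ω ω' : SiteConfig (Site 2)}
    (h : ω ∩ triMeshVertices D.carrier δ = ω' ∩ triMeshVertices D.carrier δ) :
    triLoopCollection D δ ω = triLoopCollection D δ ω' := by
  unfold triLoopCollection
  rw [h]

/-- The trace of a configuration on a set of sites, read back as a configuration, is the
restricted configuration: `Subtype.val '' {x : S | ↑x ∈ ω} = ω ∩ S`. [folklore] -/
theorem image_val_setOf_mem_eq_inter (S : Set (Site 2)) (ω : SiteConfig (Site 2)) :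
    Subtype.val '' {x : S | (x : Site 2) ∈ ω} = ω ∩ S := by
  ext y
  constructor
  · rintro ⟨x, hx, rfl⟩
    exact ⟨hx, x.2⟩
  · rintro ⟨hy, hyS⟩
    exact ⟨⟨y, hyS⟩, hy, rfl⟩

/-- **`measurable_triLoopCollection` holds**: at fixed mesh `δ > 0` the loop collection
`triLoopCollection D δ : SiteConfig (Site 2) → LoopSpace ℂ` is Borel measurable. It factors as
`g ∘ r` through the trace map `r ω = {x : S | ↑x ∈ ω}` on the finite set
`S = triMeshVertices D.carrier δ` (`triMeshVertices_finite_holds`, `D` bounded, `δ > 0`), which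
is measurable coordinatewise (`measurable_set_mem`), and any map `g` out of the finite (hence
countable, measurable-singleton) type `Set S` is measurable (`measurable_of_countable`).
Camia–Newman 2006, §2.2 (for each fixed `δ > 0` the random curves are polygonal paths on the
edges of `δ𝓗`, inducing a law on the Borel σ-algebra `𝓑_R` of closed sets of curves).
[cite: CamiaNewman2006, §2.2] -/
theorem measurable_triLoopCollection_holds : measurable_triLoopCollection := by
  intro D δ hδ
  set S : Set (Site 2) := triMeshVertices D.carrier δ with hS
  haveI : Finite S := (triMeshVertices_finite_holds D.isBounded hδ).to_subtype
  let r : SiteConfig (Site 2) → Set S := fun ω ↦ {x : S | (x : Site 2) ∈ ω}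
  let g : Set S → RandomPlanarGeometry.LoopSpace ℂ := fun A ↦ triLoopCollection D δ (Subtype.val '' A)
  have hr : Measurable r := measurable_set_iff.2 fun x ↦ measurable_set_mem (x : Site 2)
  have hg : Measurable g := measurable_of_countable g
  have hfac : triLoopCollection D δ = g ∘ r := by
    funext ω
    refine triLoopCollection_eq_of_inter_eq ?_
    change ω ∩ S = Subtype.val '' {x : S | (x : Site 2) ∈ ω} ∩ S
    rw [image_val_setOf_mem_eq_inter, Set.inter_assoc, Set.inter_self]
  rw [hfac]
  exact hg.comp hr

end Literature.Probability.Percolation
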